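import Summits.Ventures.QEC.Census.BB.BB108Rank
import Summits.Ventures.QEC.Theses.BB108DistanceCertificate
import HarnessLib

/-!
# Route BB108DistanceCertificate, item `EightLogicalQubits108` (stmt-Ventures-19830): `BB.bb108.k = 8`

Closer of the support item `EightLogicalQubits108 : (BB.bb108).k = 8` of route
`Summits/Ventures/QEC/Theses/BB108DistanceCertificate.lean` (LADDER-QEC rung Q2, the `[[108,8,10]]` bivariate-bicycle code
`QC(x³+y+y², y³+x+x²)` on `ℤ₉ × ℤ₆` of Bravyi–Cross–Gambetta–Maslov–Rall–Yoder 2024): the dimension of the typed code is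
`k = n − rank H^X − rank H^Z = 108 − 50 − 50 = 8`, both ranks established by kernel-checked RANK CERTIFICATES
(`Summits/Ventures/QEC/Census/BB/BB108Rank.lean`, p467715, qec-type-02: CERT-FORMAT v1 §3 `k_cert`, checker `RankCert.check`
by `decide +kernel`, soundness `rank_rowMatrix_of_check`, numeral rows identified with `BB.bb108.HXFlat/HZFlat` entry by
entry). This file only re-states `Census.bb108_k` at the route declaration's type; it is the one file of the item allowed to
import the Theses module (cell build rule). Tier KERNEL: axioms ⊆ {propext, Classical.choice, Quot.sound}.
-/

namespace Summit.Ventures.QEC.Theorems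

/-- **`k(BB108) = 8`** — route item `EightLogicalQubits108` (stmt-Ventures-19830) of route BB108DistanceCertificate,
discharged by the kernel-checked rank certificates of `Census/BB/BB108Rank.lean` (`Census.bb108_k`:
`rank₂ H^X = rank₂ H^Z = 50`, `k = 108 − 50 − 50`).
[cite: BravyiEtAl2024, Nature 627 (2024) Table 1 row [[108,8,10]] and §4 Lemma 1 (arXiv:2308.07915: k = n − rk H^X − rk H^Z)] -/
theorem EightLogicalQubits108_proof :
    Summit.Ventures.QEC.Theses.BB108DistanceCertificate.EightLogicalQubits108 := by
  unfold Summit.Ventures.QEC.Theses.BB108DistanceCertificate.EightLogicalQubits108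
  exact Summit.Ventures.QEC.Census.bb108_k

end Summit.Ventures.QEC.Theorems
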